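import Literature.AnabelianGeometry.SemiGraphs.TemperedCoverings
import Literature.AnabelianGeometry.SemiGraphs.OfProfiniteGroups
import Literature.AnabelianGeometry.Anabelioids.BasicProofs

/-!
# Finite étale coverings of a semi-graph of anabelioids: the two presentations ([SemiAnbd] §2/§3)

For a semi-graph of anabelioids `𝒢` presented by profinite groups (`ProfiniteSemiGraph`,
`TemperedCoverings.lean`, [SemiAnbd] §3 p. 36) the finite objects of `B^cov(𝒢)` (`BFinCat 𝒢`,
Def. 3.5 (i) p. 37: "arise from finite objects of `B^cov(𝒢)` … finite étale coverings") are the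
objects of the category `B(𝒢)` of Definition 2.1 (p. 23) of the semi-graph of anabelioids
`{B(Π_v), B(Π_e), B(b_*)}` (`SemiGraphOfGroups.toAnabelioids`, `OfProfiniteGroups.lean`).  This
file sets up the comparison: `toGroups`/`toAnab`, the constituentwise functor
`toBTemp : ContAction FintypeCat Π ⥤ BTemp Π` (a finite continuous `Π`-set is a countable `Π`-set
with open stabilisers) and the functor `ofBObj : 𝒢.toAnab.BObj ⥤ CovObj 𝒢`.
-/

namespace Literature.AnabelianGeometry.SemiGraphs

open CategoryTheory Literature.AnabelianGeometry.Anabelioids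
open Literature.AlgebraicGeometry.Frobenioids (BCat)
open scoped FintypeCatDiscrete Pointwise

universe u

section ToBTemp

variable (G : Type u) [Group G] [TopologicalSpace G] [IsTopologicalGroup G]

/-- A finite continuous `Π`-set is an object of `B^temp(Π)` (finite ⇒ countable; continuity for the
discrete topology ⇒ open stabilisers): the functor `B(Π) ⥤ B^temp(Π)` on underlying `Π`-sets.
[cite: MochizukiSemiAnbd2006, Def 3.5(i) p.37] -/
noncomputable def toBTemp : ContAction FintypeCat.{u} G ⥤ BTemp G :=
  ObjectProperty.lift _ (ObjectProperty.ι _ ⋙ FintypeCat.incl.mapAction G) fun X => by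
    refine ⟨?_, fun x => ?_⟩
    · change Countable X.obj.V.obj
      infer_instance
    · have h := (isContinuous_iff_stabilizer_isOpen X.obj).mp X.property x
      have hx : IsOpen {g : G | (X.obj.ρ g).hom x = x} := by
        have e : {g : G | (X.obj.ρ g).hom x = x} =
            (MulAction.stabilizer G (show X.obj.V from x) : Set G) := Set.ext fun _ => Iff.rfl
        rw [e]
        exact h
      exact hx

/-- `toBTemp` commutes with restriction along a continuous homomorphism (definitionally on
objects). [cite: MochizukiSemiAnbd2006, Rmk 3.1.2 pp.33-34] -/
theorem toBTemp_res_obj {H : Type u} [Group H] [TopologicalSpace H] [IsTopologicalGroup H]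
    (f : G →ₜ* H) (X : ContAction FintypeCat.{u} H) :
    ((toBTemp G).obj ((ContAction.res FintypeCat.{u} f).obj X)).obj =
      ((BTemp.res f).obj ((toBTemp H).obj X)).obj := rfl

end ToBTemp

namespace ProfiniteSemiGraph

variable (𝒢 : ProfiniteSemiGraph.{u})

/-- The semi-graph of profinite groups underlying `𝒢` in the presentation of
`OfProfiniteGroups.lean`. [cite: MochizukiSemiAnbd2006, Def. 2.1 p.23] -/
def toGroups : SemiGraphOfGroups 𝒢.graph where
  GV := 𝒢.Gv
  GE := 𝒢.Ge
  hom := 𝒢.brHom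

/-- The semi-graph of anabelioids `{B(Π_v), B(Π_e), B(b_*)}` of `𝒢` (Def. 2.1 p. 23).
[cite: MochizukiSemiAnbd2006, Def. 2.1 p.23] -/
noncomputable abbrev toAnab : SemiGraphOfAnabelioids.{u, u + 1, u} := 𝒢.toGroups.toAnabelioids

/-- The object of `B^cov(𝒢)` underlying an object of `B(𝒢)` (a finite étale covering): the same
finite `Π_v`-, `Π_e`-sets and gluings. [cite: MochizukiSemiAnbd2006, Def 3.5(i) p.37] -/
noncomputable def ofBObjObj (X : 𝒢.toAnab.BObj) : CovObj 𝒢 where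
  SV v := (toBTemp (𝒢.Gv v)).obj (X.S v)
  SE e := (toBTemp (𝒢.Ge e)).obj (X.T e)
  glue b v h := (temperedAction (𝒢.Ge (𝒢.graph.edgeOf b))).isoMk
    ((FintypeCat.incl.mapAction (𝒢.Ge (𝒢.graph.edgeOf b))).mapIso
      ((ObjectProperty.ι _).mapIso (X.ψ b v h).symm))

/-- The functor `B(𝒢) ⥤ B^cov(𝒢)` (finite étale coverings as coverings).
[cite: MochizukiSemiAnbd2006, Def 3.5(i) p.37] -/
noncomputable def ofBObj : 𝒢.toAnab.BObj ⥤ CovObj 𝒢 where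
  obj := 𝒢.ofBObjObj
  map {X Y} f :=
    { fV := fun v => (toBTemp (𝒢.Gv v)).map (f.fS v)
      fE := fun e => (toBTemp (𝒢.Ge e)).map (f.fT e)
      comm := fun b v h => by
        apply ObjectProperty.hom_ext
        apply Action.Hom.ext
        apply ConcreteCategory.hom_ext
        intro x
        -- componentwise: `fT ∘ ψ_X⁻¹ = ψ_Y⁻¹ ∘ b^* fS`, from `f.comm`
        have hc := f.comm b v h
        have hc' : f.fT _ ≫ (Y.ψ b v h).inv =
            (X.ψ b v h).inv ≫ (𝒢.toAnab.pull b v h).pullback.map (f.fS v) := by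
          rw [Iso.comp_inv_eq, Category.assoc, Iso.eq_inv_comp]
          exact hc.symm
        exact congrArg (fun φ => φ.hom.hom x) hc' }
  map_id X := by
    refine CovHom.ext (funext fun v => ?_) (funext fun e => ?_)
    · exact (toBTemp (𝒢.Gv v)).map_id _
    · exact (toBTemp (𝒢.Ge e)).map_id _
  map_comp f g := by
    refine CovHom.ext (funext fun v => ?_) (funext fun e => ?_)
    · exact (toBTemp (𝒢.Gv v)).map_comp _ _
    · exact (toBTemp (𝒢.Ge e)).map_comp _ _

end ProfiniteSemiGraph

end Literature.AnabelianGeometry.SemiGraphs
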